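import Summits.QuantumFields.GaugeBoot.ZdPlaquetteInsertion
import Summits.QuantumFields.GaugeBoot.PeriodicLoopEquation
import Summits.QuantumFields.GaugeBoot.WordLoopZdLimit
import HarnessLib

/-!
# The differentiated one-link Schwinger–Dyson identity of a Haar-shift state on `ℤ^d`: pair form and polarisation (gauge-boot, `ℤ^d` loop equations 2/4)

HONEST FRAMING (cell `pub-gaugeboot`, page 1 of every file): the venture produces certified bounds
on lattice expectations at stated coupling, gauge group, dimension and torus size; NOT a mass gap,
NOT a continuum limit, NOT a string tension; NOT Yang–Mills-summit-bearing (barriers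
`FixedCouplingUltralocality`, `PerturbativeInvisibility`).

File 2/4 of the derivation "Haar-shift identity ⇒ loop equations" on the INFINITE lattice `ℤ^d`
(the `haarShift` axiom of `ClassBState` / `TiltedClassState`), the `ℤ^d` analogue of
`PeriodicSchwingerDyson.lean` (file 4/5 of the periodic stack) with the Wilson measure `gibbs ρ e β` of
a finite periodic lattice replaced by an ARBITRARY finite measure `μ` on `LGConfig d G` satisfying
`IsHaarShiftState ρ β μ` (`ClassB.lean`):

* **`IsHaarShiftState.integral_shiftDeriv_eq`** — the DIFFERENTIATED one-link Haar-shift identity: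
  for a multiplicative family `k : ℝ → G`, a continuous CYLINDER observable `f` with a continuous
  derivative `f'` along the left shift `U ↦ U[l ↦ k(t)U_l]` at `t = 0`, and `S'` a continuous derivative
  of the boundary action `S_{l} = wilsonBoundaryAction ρ {l}` along the same shift,
  `∫ f' dμ = β ∫ f S' dμ` (compact second countable `G`, continuous `ρ`, every real `β`). Proof:
  differentiate the Haar-shift identity at `t = 0` under the integral sign on both sides (bounded
  Lipschitz families on the compact configuration space `LGConfig d G`; the tree's
  `hasDerivAt_integral_of_bounded_lipschitz`, `lipschitz_of_flow`) — verbatim the periodic proof, the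
  cylinder hypothesis being what `IsHaarShiftState` asks of its test functions;
* `IsHaarShiftState.integral_shiftDeriv_eq_complex`; **`IsHaarShiftState.sd_pair`** — for a lattice
  representation `r`, an admissible direction `X`, ANY matrix `Y`, any word `w` from `x₀` and the link
  `(x, μ)`: `∫ tr(Y·insDeriv_X hol_w) dμ = β ∫ tr(Y·ρ(hol_w))·(−½ plaqIns_X) dμ` (file 1/4:
  `actionDerivZd_eq_plaqIns`);
* `SDPairZd μ r β x μ x₀ w X` (the identity as a predicate in `X`), POLARISATION
  (`sdPairZd_of_parts/traceless/skew`) and the groups: **`sdPairZd_specialUnitaryGroup`** (every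
  traceless direction, `SU(N)`), **`sdPairZd_unitaryGroup`** (every direction, `U(N)`).

Everything is `[folklore]`; `G : Type`. References: M. Creutz, *Quarks, gluons and lattices* (1983)
Ch. 11; S. Chatterjee, Comm. Math. Phys. 366 (2019) §8; E. Seiler, LNP 159 (1982) Ch. 2; H.-O. Georgii,
*Gibbs Measures and Phase Transitions* (2011) Def. 2.9; S. Cao, M. Park, S. Sheffield, Comm. AMS 5 (2025)
Thm. 5.7 (`U(N)`) / Thm. 6.104 (`SU(N)`) (arXiv:2307.06790 numbering; informally Thm. 1.14).
-/

noncomputable section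

open MeasureTheory Filter Topology NormedSpace
open scoped Matrix.Norms.Frobenius Matrix
open Literature.Probability.LatticeModels (Site)
open Literature.MathematicalPhysics.QuantumLattice (LGConfig ZdEdge IsCylinder wilsonBoundaryAction
  fundamentalLatticeRep unitaryFundamentalLatticeRep mem_oneParamGenerators_specialUnitaryGroup
  mem_oneParamGenerators_unitaryGroup)
open Literature.MathematicalPhysics.QuantumFieldTheory (LatticeRep)
open Summit.QuantumFields.YangMills.Theorems.EquipartitionPinsProbe.TangentSteinFiniteBeta
  (lipschitz_of_flow abs_exp_sub_exp_le exists_abs_le_of_continuous)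
open Summit.QuantumFields.YangMills.Theorems.EquipartitionPinsProbe.TangentDiffIdentity
  (hasDerivAt_integral_of_bounded_lipschitz)
open Summit.QuantumFields.YangMills.Cruxes.CurvatureAmnesia.WardDefect.SchwingerDyson (oneParam_neg)

namespace Summit.QuantumFields.GaugeBoot

variable {d N : ℕ} {G : Type} [Group G] [TopologicalSpace G] [IsTopologicalGroup G] [CompactSpace G]
  [MeasurableSpace G] [BorelSpace G]

/-! ### The differentiated one-link Haar-shift identity -/

section Identity

variable [SecondCountableTopology G] (ρ : G →* Matrix (Fin N) (Fin N) ℂ)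

/-- **One-link Schwinger–Dyson (integration-by-parts) identity for a Haar-shift state on `ℤ^d`.**
For compact second countable `G`, continuous `ρ`, a real coupling `β`, a finite measure `μ` on
`LGConfig d G` with `IsHaarShiftState ρ β μ`, a link `l` and a multiplicative family `k : ℝ → G`: if the
real CYLINDER observable `f` is continuous with a continuous derivative `f'` along the left shift
`U ↦ U[l ↦ k(t)U_l]` at `t = 0`, and `S'` is a continuous derivative of the boundary action
`wilsonBoundaryAction ρ {l}` along the same shift, then `∫ f' dμ = β ∫ f S' dμ`. Proof: differentiate
the Haar-shift identity at `t = 0` under the integral sign. [folklore] -/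
theorem IsHaarShiftState.integral_shiftDeriv_eq (hρ : Continuous ρ) {β : ℝ} {μ : Measure (LGConfig d G)}
    [IsFiniteMeasure μ] (hμ : IsHaarShiftState ρ β μ) (l : ZdEdge d) {k : ℝ → G}
    (hk : ∀ s t, k (s + t) = k s * k t) (f f' : LGConfig d G → ℝ) {T₀ : Finset (ZdEdge d)}
    (hfT : IsCylinder f T₀) (hf : Continuous f) (hf'c : Continuous f')
    (hf' : ∀ U, HasDerivAt (fun t => f (Function.update U l (k t * U l))) (f' U) 0)
    (S' : LGConfig d G → ℝ) (hS'c : Continuous S')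
    (hS' : ∀ U, HasDerivAt (fun t => wilsonBoundaryAction ρ {l} (Function.update U l (k t * U l)))
      (S' U) 0) :
    ∫ U, f' U ∂μ = β * ∫ U, f U * S' U ∂μ := by
  set S := wilsonBoundaryAction (d := d) (G := G) ρ {l} with hSdef
  set T : ℝ → LGConfig d G → LGConfig d G := fun t U => Function.update U l (k t * U l) with hT
  have hflow : ∀ s t U, T (t + s) U = T t (T s U) := fun s t U => TiltedRP.update_shift_flow hk l s t U
  have hT0 : ∀ U, T 0 U = U := fun U => TiltedRP.update_shift_zero hk l U
  have hTc : ∀ t, Continuous (T t) := fun t => TiltedRP.continuous_update_shift l (k t)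
  have hf'T : ∀ U, HasDerivAt (fun t => f (T t U)) (f' U) 0 := hf'
  have hS'T : ∀ U, HasDerivAt (fun t => S (T t U)) (S' U) 0 := hS'
  obtain ⟨Cf, hCf0, hCf⟩ := exists_abs_le_of_continuous hf
  obtain ⟨Cf', -, hCf'⟩ := exists_abs_le_of_continuous hf'c
  obtain ⟨CS', hCS'0, hCS'⟩ := exists_abs_le_of_continuous hS'c
  have hSc : Continuous S := by
    rw [hSdef]
    unfold wilsonBoundaryAction
    exact continuous_finsetSum _ fun p _ =>
      continuous_const.sub (TiltedRP.continuous_plaqObs ρ hρ (TiltedRP.zdUnit d) p)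
  obtain ⟨CS, -, hCS⟩ := exists_abs_le_of_continuous hSc
  have hAB : ∀ t : ℝ, ∫ U, f (T t U) ∂μ = ∫ U, f U * Real.exp (-(β * (S (T (-t) U) - S U))) ∂μ := by
    intro t
    have h := hμ l (k t) f T₀ hfT hf
    rw [← oneParam_neg hk t] at h
    exact h
  have hAd : HasDerivAt (fun t : ℝ => ∫ U, f (T t U) ∂μ) (∫ U, f' U ∂μ) 0 := by
    refine hasDerivAt_integral_of_bounded_lipschitz μ (fun t U => f (T t U)) f' (Cf + Cf')
      (fun t => (hf.comp (hTc t)).measurable) hf'c.measurable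
      (fun t U => (hCf _).trans (le_add_of_nonneg_right ?_)) (fun U t s => ?_) hf'T
    · exact (abs_nonneg _).trans (hCf' U)
    · calc |f (T t U) - f (T s U)| ≤ Cf' * |t - s| := lipschitz_of_flow T hflow f f' hf'T hCf' U t s
        _ ≤ (Cf + Cf') * |t - s| := by gcongr; linarith [(abs_nonneg _).trans (hCf U)]
  have hBd : HasDerivAt (fun t : ℝ => ∫ U, f U * Real.exp (-(β * (S (T (-t) U) - S U))) ∂μ)
      (∫ U, f U * (β * S' U) ∂μ) 0 := by
    set M := |β| * (2 * CS) with hMdef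
    have hM : ∀ t U, -(β * (S (T (-t) U) - S U)) ≤ M := fun t U => by
      have h1 := hCS (T (-t) U)
      have h2 := hCS U
      calc -(β * (S (T (-t) U) - S U)) ≤ |β * (S (T (-t) U) - S U)| := neg_le_abs _
        _ = |β| * |S (T (-t) U) - S U| := abs_mul _ _
        _ ≤ |β| * (2 * CS) := by
            gcongr
            calc |S (T (-t) U) - S U| ≤ |S (T (-t) U)| + |S U| := abs_sub _ _
              _ ≤ CS + CS := add_le_add h1 h2
              _ = 2 * CS := by ring
    have hE : ∀ t U, |Real.exp (-(β * (S (T (-t) U) - S U)))| ≤ Real.exp M := fun t U => by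
      rw [abs_of_pos (Real.exp_pos _)]
      exact Real.exp_le_exp.2 (hM t U)
    have hSlip : ∀ U t s, |S (T (-t) U) - S (T (-s) U)| ≤ CS' * |t - s| := fun U t s => by
      have h := lipschitz_of_flow T hflow S S' hS'T hCS' U (-t) (-s)
      rwa [show |(-t) - (-s)| = |t - s| by rw [neg_sub_neg, abs_sub_comm]] at h
    refine hasDerivAt_integral_of_bounded_lipschitz μ
      (fun t U => f U * Real.exp (-(β * (S (T (-t) U) - S U)))) (fun U => f U * (β * S' U))
      (Cf * Real.exp M + Cf * (Real.exp M * (|β| * CS'))) (fun t => ?_) ?_ (fun t U => ?_)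
      (fun U t s => ?_) (fun U => ?_)
    · exact (hf.mul (Real.continuous_exp.comp
        (((hSc.comp (hTc (-t))).sub hSc).const_mul β).neg)).measurable
    · exact (hf.mul (hS'c.const_mul β)).measurable
    · calc |f U * Real.exp (-(β * (S (T (-t) U) - S U)))|
          = |f U| * |Real.exp (-(β * (S (T (-t) U) - S U)))| := abs_mul _ _
        _ ≤ Cf * Real.exp M := mul_le_mul (hCf U) (hE t U) (abs_nonneg _) hCf0
        _ ≤ Cf * Real.exp M + Cf * (Real.exp M * (|β| * CS')) := le_add_of_nonneg_right (by positivity)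
    · have hx : -(β * (S (T (-t) U) - S U)) ≤ M := hM t U
      have hy : -(β * (S (T (-s) U) - S U)) ≤ M := hM s U
      calc |f U * Real.exp (-(β * (S (T (-t) U) - S U))) - f U * Real.exp (-(β * (S (T (-s) U) - S U)))|
          = |f U| * |Real.exp (-(β * (S (T (-t) U) - S U))) -
              Real.exp (-(β * (S (T (-s) U) - S U)))| := by rw [← mul_sub, abs_mul]
        _ ≤ Cf * (Real.exp M * |(-(β * (S (T (-t) U) - S U))) - (-(β * (S (T (-s) U) - S U)))|) :=
            mul_le_mul (hCf U) (abs_exp_sub_exp_le hx hy) (abs_nonneg _) hCf0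
        _ = Cf * (Real.exp M * (|β| * |S (T (-t) U) - S (T (-s) U)|)) := by
            rw [show -(β * (S (T (-t) U) - S U)) - -(β * (S (T (-s) U) - S U)) =
              -(β * (S (T (-t) U) - S (T (-s) U))) by ring, abs_neg, abs_mul]
        _ ≤ Cf * (Real.exp M * (|β| * (CS' * |t - s|))) := by gcongr; exact hSlip U t s
        _ = Cf * (Real.exp M * (|β| * CS')) * |t - s| := by ring
        _ ≤ (Cf * Real.exp M + Cf * (Real.exp M * (|β| * CS'))) * |t - s| := by
            have : 0 ≤ Cf * Real.exp M * |t - s| := by positivity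
            nlinarith [this]
    · have hSneg : HasDerivAt (fun t : ℝ => S (T (-t) U)) (-(S' U)) 0 := by
        have h0 : HasDerivAt (fun t : ℝ => S (T t U)) (S' U) (-0) := by rw [neg_zero]; exact hS'T U
        have h := h0.scomp (0 : ℝ) (hasDerivAt_neg (0 : ℝ))
        simpa [Function.comp_def] using h
      have hin : HasDerivAt (fun t : ℝ => -(β * (S (T (-t) U) - S U))) (β * S' U) 0 := by
        exact (((hSneg.sub_const (S U)).const_mul β).neg).congr_deriv (by ring)
      have hexp := hin.exp
      have h0 : -(β * (S (T (-0) U) - S U)) = 0 := by rw [neg_zero, hT0, sub_self, mul_zero, neg_zero]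
      rw [h0, Real.exp_zero, one_mul] at hexp
      exact hexp.const_mul (f U)
  have hEq : (fun t : ℝ => ∫ U, f (T t U) ∂μ) =
      fun t : ℝ => ∫ U, f U * Real.exp (-(β * (S (T (-t) U) - S U))) ∂μ := funext hAB
  rw [hEq] at hAd
  rw [hAd.unique hBd, ← integral_const_mul]
  refine integral_congr_ae (ae_of_all _ fun U => ?_)
  ring

end Identity

namespace TiltedRP

/-! ### Lattice representations: complex observables and the pair identity -/

section SDPair

omit [IsTopologicalGroup G] in
/-- Continuous (complex) observables on the compact configuration space `LGConfig d G` are integrable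
for every finite measure (given the faithful representation `r`, which makes `G` second countable).
[folklore] -/
theorem integrable_of_continuous_zd (r : LatticeRep G) (μ : Measure (LGConfig d G)) [IsFiniteMeasure μ]
    {F : LGConfig d G → ℂ} (hF : Continuous F) : Integrable F μ := by
  haveI : SecondCountableTopology G :=
    (r.continuous.isClosedEmbedding r.injective).isEmbedding.secondCountableTopology
  obtain ⟨C, hC⟩ := isCompact_univ.exists_bound_of_continuousOn hF.continuousOn
  exact Integrable.of_bound hF.measurable.aestronglyMeasurable C (ae_of_all _ fun U => hC U (Set.mem_univ U))

/-- **Complex-valued one-link Schwinger–Dyson identity** of a Haar-shift state on `ℤ^d` (real and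
imaginary parts of `IsHaarShiftState.integral_shiftDeriv_eq`). [folklore] -/
theorem integral_shiftDeriv_eq_complex (r : LatticeRep G) {β : ℝ} {μ : Measure (LGConfig d G)}
    [IsFiniteMeasure μ]
    (hμ : IsHaarShiftState r.ρ β μ) (l : ZdEdge d) {k : ℝ → G} (hk : ∀ s t, k (s + t) = k s * k t)
    (f f' : LGConfig d G → ℂ) {T₀ : Finset (ZdEdge d)} (hfT : IsCylinder f T₀) (hf : Continuous f)
    (hf'c : Continuous f')
    (hf' : ∀ U, HasDerivAt (fun t => f (Function.update U l (k t * U l))) (f' U) 0)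
    (S' : LGConfig d G → ℝ) (hS'c : Continuous S')
    (hS' : ∀ U, HasDerivAt (fun t => wilsonBoundaryAction r.ρ {l} (Function.update U l (k t * U l)))
      (S' U) 0) :
    ∫ U, f' U ∂μ = (β : ℂ) * ∫ U, f U * (S' U : ℂ) ∂μ := by
  haveI : SecondCountableTopology G :=
    (r.continuous.isClosedEmbedding r.injective).isEmbedding.secondCountableTopology
  have hre := hμ.integral_shiftDeriv_eq r.ρ r.continuous l hk (fun U => (f U).re)
    (fun U => (f' U).re) (T₀ := T₀) (fun U V h => congrArg Complex.re (hfT h))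
    (Complex.continuous_re.comp hf) (Complex.continuous_re.comp hf'c)
    (fun U => by simpa [Function.comp_def] using (Complex.reCLM.hasFDerivAt.comp_hasDerivAt (0 : ℝ) (hf' U)))
    S' hS'c hS'
  have him := hμ.integral_shiftDeriv_eq r.ρ r.continuous l hk (fun U => (f U).im)
    (fun U => (f' U).im) (T₀ := T₀) (fun U V h => congrArg Complex.im (hfT h))
    (Complex.continuous_im.comp hf) (Complex.continuous_im.comp hf'c)
    (fun U => by simpa [Function.comp_def] using (Complex.imCLM.hasFDerivAt.comp_hasDerivAt (0 : ℝ) (hf' U)))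
    S' hS'c hS'
  have hi1 : Integrable f' μ := integrable_of_continuous_zd r μ hf'c
  have hi2 : Integrable (fun U => f U * (S' U : ℂ)) μ :=
    integrable_of_continuous_zd r μ (hf.mul (Complex.continuous_ofReal.comp hS'c))
  apply Complex.ext
  · have h1 := Complex.reCLM.integral_comp_comm hi1
    have h2 := Complex.reCLM.integral_comp_comm hi2
    simp only [Complex.reCLM_apply, Complex.mul_re, Complex.ofReal_re, Complex.ofReal_im, mul_zero,
      sub_zero] at h1 h2
    rw [← h1, hre, Complex.re_ofReal_mul, ← h2]
  · have h1 := Complex.imCLM.integral_comp_comm hi1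
    have h2 := Complex.imCLM.integral_comp_comm hi2
    simp only [Complex.imCLM_apply, Complex.mul_im, Complex.ofReal_re, Complex.ofReal_im, mul_zero,
      zero_add] at h1 h2
    rw [← h1, him, Complex.im_ofReal_mul, ← h2]

omit [TopologicalSpace G] [IsTopologicalGroup G] [CompactSpace G] [MeasurableSpace G] [BorelSpace G] in
/-- Word holonomies on `ℤ^d` (periodic notation) are cylinder functions. [folklore] -/
theorem exists_isCylinder_wordHolonomy_zdUnit (x₀ : Site d) (w : Word d) :
    ∃ T₀ : Finset (ZdEdge d), IsCylinder (fun U : LGConfig d G => wordHolonomy (zdUnit d) U x₀ w) T₀ := by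
  obtain ⟨T₀, hT₀⟩ := exists_dependsOn_wordHolonomyZd (G := G) x₀ w
  exact ⟨T₀, fun U V h => by simpa only [wordHolonomy_zdUnit] using hT₀ U V h⟩

/-- **The one-link Schwinger–Dyson identity for a word, for a Haar-shift state on `ℤ^d` (pair
form).** For an admissible direction `X` (skew-Hermitian, `r.ρ(k t) = exp(tX)` for a one-parameter
subgroup `k`), ANY matrix `Y`, any word `w` read from `x₀`, and the link `(x, μ)`:
`∫ tr(Y·insDeriv_X hol_w) dμ = β ∫ tr(Y·ρ(hol_w)) · (−½ plaqIns_X) dμ`. [folklore] -/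
theorem sd_pair_zd (r : LatticeRep G) {β : ℝ} {μW : Measure (LGConfig d G)} [IsFiniteMeasure μW]
    (hμ : IsHaarShiftState r.ρ β μW) (x : Site d) (μ : Fin d) {k : ℝ → G}
    (hk : ∀ s t, k (s + t) = k s * k t) {X : Matrix (Fin r.N) (Fin r.N) ℂ}
    (hX : ∀ t, r.ρ (k t) = exp ((t : ℂ) • X)) (hXs : Xᴴ = -X) (Y : Matrix (Fin r.N) (Fin r.N) ℂ)
    (x₀ : Site d) (w : Word d) :
    ∫ U, (Y * insDeriv r.ρ (zdUnit d) (x, μ) X U x₀ w).trace ∂μW =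
      (β : ℂ) * ∫ U, (Y * r.ρ (wordHolonomy (zdUnit d) U x₀ w)).trace *
        (-(1 / 2) * plaqIns r.ρ (zdUnit d) X U x μ) ∂μW := by
  obtain ⟨T₀, hT₀⟩ := exists_isCylinder_wordHolonomy_zdUnit (G := G) x₀ w
  have h := integral_shiftDeriv_eq_complex r hμ (x, μ) hk
    (fun U => (Y * r.ρ (wordHolonomy (zdUnit d) U x₀ w)).trace)
    (fun U => (Y * insDeriv r.ρ (zdUnit d) (x, μ) X U x₀ w).trace) (T₀ := T₀)
    (fun U V hUV => by simp only [hT₀ hUV])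
    ((continuous_const.mul (r.continuous.comp (continuous_wordHolonomy (zdUnit d) x₀ w))).matrix_trace)
    ((continuous_const.mul (continuous_insDeriv (zdUnit d) (x, μ) r.continuous x₀ w)).matrix_trace)
    (fun U => by
      have hd := (traceMulLeftCLM Y).hasFDerivAt.comp_hasDerivAt (0 : ℝ)
        (hasDerivAt_wordHolonomy (zdUnit d) (x, μ) hk hX U x₀ w)
      simpa [Function.comp_def] using hd.congr_deriv (traceMulLeftCLM_apply Y _))
    (actionDerivZd r.ρ (x, μ) X) (continuous_actionDerivZd (x, μ) r.continuous)
    (fun U => hasDerivAt_wilsonBoundaryAction (x, μ) hk hX U)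
  rw [h]
  congr 1
  refine integral_congr_ae (ae_of_all _ fun U => ?_)
  simp only [actionDerivZd_eq_plaqIns hXs r.mem_unitary U x μ]

end SDPair

/-! ### Polarisation -/

section Polarisation

variable (μW : Measure (LGConfig d G)) (r : LatticeRep G)

/-- THE PAIR IDENTITY for the direction `X` and a measure `μ` on `ℤ^d` configurations (word `w` from
`x₀`, link `(x, μ)`, coupling `β`): for every `Y`,
`∫ tr(Y·insDeriv_X hol_w) dμ = β ∫ tr(Y ρ(hol_w))·(−½ plaqIns_X) dμ`. [shape] A parametric definition
of a proposition organising the proof — NOT a named fact. [folklore] -/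
def SDPairZd (β : ℝ) (x : Site d) (μ : Fin d) (x₀ : Site d) (w : Word d)
    (X : Matrix (Fin r.N) (Fin r.N) ℂ) : Prop :=
  ∀ Y : Matrix (Fin r.N) (Fin r.N) ℂ,
    ∫ U, (Y * insDeriv r.ρ (zdUnit d) (x, μ) X U x₀ w).trace ∂μW =
      (β : ℂ) * ∫ U, (Y * r.ρ (wordHolonomy (zdUnit d) U x₀ w)).trace *
        (-(1 / 2) * plaqIns r.ρ (zdUnit d) X U x μ) ∂μW

variable {μW}

/-- `sd_pair_zd` restated: for a Haar-shift state, admissible skew-Hermitian directions satisfy the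
pair identity. [folklore] -/
theorem sdPairZd_of_oneParam [IsFiniteMeasure μW] {β : ℝ} (hμ : IsHaarShiftState r.ρ β μW) (x : Site d)
    (μ : Fin d) (x₀ : Site d) (w : Word d) {X : Matrix (Fin r.N) (Fin r.N) ℂ} (hXs : Xᴴ = -X)
    {k : ℝ → G} (hk : ∀ s t, k (s + t) = k s * k t) (hX : ∀ t, r.ρ (k t) = exp ((t : ℂ) • X)) :
    SDPairZd μW r β x μ x₀ w X :=
  fun Y => sd_pair_zd r hμ x μ hk hX hXs Y x₀ w

/-- **Polarisation step**: the pair identity for the two skew-Hermitian parts of `X` implies it for `X`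
(both sides are `ℂ`-linear in `X`). [folklore] -/
theorem sdPairZd_of_parts [IsFiniteMeasure μW] (β : ℝ) (x : Site d) (μ : Fin d) (x₀ : Site d) (w : Word d)
    (X : Matrix (Fin r.N) (Fin r.N) ℂ) (hPA : SDPairZd μW r β x μ x₀ w ((1 / 2 : ℂ) • (X - Xᴴ)))
    (hPB : SDPairZd μW r β x μ x₀ w ((Complex.I / 2) • (X + Xᴴ))) : SDPairZd μW r β x μ x₀ w X := by
  set A₁ : Matrix (Fin r.N) (Fin r.N) ℂ := (1 / 2 : ℂ) • (X - Xᴴ) with hA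
  set B₁ : Matrix (Fin r.N) (Fin r.N) ℂ := (Complex.I / 2) • (X + Xᴴ) with hB
  have hXAB : X = A₁ + (-Complex.I) • B₁ := eq_skewPart_add X
  clear_value A₁ B₁
  intro Y
  have hiA := integrable_of_continuous_zd r μW
    (continuous_trace_mul_insDeriv r (zdUnit d) Y A₁ (x, μ) x₀ w)
  have hiB := integrable_of_continuous_zd r μW
    (continuous_trace_mul_insDeriv r (zdUnit d) Y B₁ (x, μ) x₀ w)
  have hjA := integrable_of_continuous_zd r μW (continuous_rhsIntegrand r (zdUnit d) Y A₁ x μ x₀ w)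
  have hjB := integrable_of_continuous_zd r μW (continuous_rhsIntegrand r (zdUnit d) Y B₁ x μ x₀ w)
  have hl : ∀ U : LGConfig d G, (Y * insDeriv r.ρ (zdUnit d) (x, μ) X U x₀ w).trace =
      (Y * insDeriv r.ρ (zdUnit d) (x, μ) A₁ U x₀ w).trace +
        (-Complex.I) * (Y * insDeriv r.ρ (zdUnit d) (x, μ) B₁ U x₀ w).trace := by
    intro U
    rw [hXAB, insDeriv_add, insDeriv_smul, Matrix.mul_add, Matrix.mul_smul, Matrix.trace_add,
      Matrix.trace_smul, smul_eq_mul]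
  have hr : ∀ U : LGConfig d G,
      (Y * r.ρ (wordHolonomy (zdUnit d) U x₀ w)).trace * (-(1 / 2) * plaqIns r.ρ (zdUnit d) X U x μ) =
        (Y * r.ρ (wordHolonomy (zdUnit d) U x₀ w)).trace *
            (-(1 / 2) * plaqIns r.ρ (zdUnit d) A₁ U x μ) +
          (-Complex.I) * ((Y * r.ρ (wordHolonomy (zdUnit d) U x₀ w)).trace *
            (-(1 / 2) * plaqIns r.ρ (zdUnit d) B₁ U x μ)) := by
    intro U
    rw [hXAB, plaqIns_add, plaqIns_smul]
    ring
  simp_rw [hl, hr]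
  rw [integral_add hiA (hiB.const_mul _), integral_const_mul, integral_add hjA (hjB.const_mul _),
    integral_const_mul, hPA Y, hPB Y]
  ring

/-- **Polarisation (`𝔰𝔲`-type).** If every traceless skew-Hermitian direction satisfies the pair
identity, so does every traceless direction. [folklore] -/
theorem sdPairZd_of_traceless [IsFiniteMeasure μW] (β : ℝ) (x : Site d) (μ : Fin d) (x₀ : Site d)
    (w : Word d)
    (hadm : ∀ X : Matrix (Fin r.N) (Fin r.N) ℂ, Xᴴ = -X → X.trace = 0 → SDPairZd μW r β x μ x₀ w X)
    (X : Matrix (Fin r.N) (Fin r.N) ℂ) (hX : X.trace = 0) : SDPairZd μW r β x μ x₀ w X :=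
  sdPairZd_of_parts r β x μ x₀ w X (hadm _ (conjTranspose_skewPart X) (trace_parts_eq_zero hX _).1)
    (hadm _ (conjTranspose_iHermPart X) (trace_parts_eq_zero hX _).2)

/-- **Polarisation (`𝔲`-type).** If every skew-Hermitian direction satisfies the pair identity, so
does every direction. [folklore] -/
theorem sdPairZd_of_skew [IsFiniteMeasure μW] (β : ℝ) (x : Site d) (μ : Fin d) (x₀ : Site d) (w : Word d)
    (hadm : ∀ X : Matrix (Fin r.N) (Fin r.N) ℂ, Xᴴ = -X → SDPairZd μW r β x μ x₀ w X)
    (X : Matrix (Fin r.N) (Fin r.N) ℂ) : SDPairZd μW r β x μ x₀ w X :=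
  sdPairZd_of_parts r β x μ x₀ w X (hadm _ (conjTranspose_skewPart X)) (hadm _ (conjTranspose_iHermPart X))

end Polarisation

/-! ### `SU(N)` and `U(N)` -/

section Concrete

/-- **`SU(N)` Haar-shift states on `ℤ^d`: every traceless direction satisfies the pair identity** —
a traceless skew-Hermitian `X` generates the one-parameter subgroup `t ↦ exp(tX)` of `SU(N)` (tree
`mem_oneParamGenerators_specialUnitaryGroup`), then polarisation. [folklore] -/
theorem sdPairZd_specialUnitaryGroup (N : ℕ) {β : ℝ}
    {μW : Measure (LGConfig d (Matrix.specialUnitaryGroup (Fin N) ℂ))} [IsFiniteMeasure μW]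
    (hμ : IsHaarShiftState (fundamentalLatticeRep N).ρ β μW) (x : Site d) (μ : Fin d) (x₀ : Site d)
    (w : Word d) (X : Matrix (Fin N) (Fin N) ℂ) (hX : X.trace = 0) :
    SDPairZd μW (fundamentalLatticeRep N) β x μ x₀ w X := by
  refine sdPairZd_of_traceless (fundamentalLatticeRep N) β x μ x₀ w (fun X hXs hX0 => ?_) X hX
  have hmem := mem_oneParamGenerators_specialUnitaryGroup (n := Fin N) (X := X) hXs hX0
  refine sdPairZd_of_oneParam (fundamentalLatticeRep N) hμ x μ x₀ w hXs
    (k := fun t => ⟨NormedSpace.exp (t • X), hmem t⟩) (fun a b => Subtype.ext ?_) (fun t => ?_)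
  · change NormedSpace.exp ((a + b) • X) = NormedSpace.exp (a • X) * NormedSpace.exp (b • X)
    rw [add_smul]
    exact Matrix.exp_add_of_commute _ _ (((Commute.refl X).smul_left a).smul_right b)
  · change NormedSpace.exp (t • X) = NormedSpace.exp ((t : ℂ) • X)
    rw [Complex.coe_smul]

/-- **`U(N)` Haar-shift states on `ℤ^d`: every direction satisfies the pair identity** — a
skew-Hermitian `X` generates the one-parameter subgroup `t ↦ exp(tX)` of `U(N)` (tree
`mem_oneParamGenerators_unitaryGroup`), then polarisation. [folklore] -/
theorem sdPairZd_unitaryGroup (N : ℕ) {β : ℝ}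
    {μW : Measure (LGConfig d (Matrix.unitaryGroup (Fin N) ℂ))} [IsFiniteMeasure μW]
    (hμ : IsHaarShiftState (unitaryFundamentalLatticeRep N).ρ β μW) (x : Site d) (μ : Fin d)
    (x₀ : Site d) (w : Word d) (X : Matrix (Fin N) (Fin N) ℂ) :
    SDPairZd μW (unitaryFundamentalLatticeRep N) β x μ x₀ w X := by
  refine sdPairZd_of_skew (unitaryFundamentalLatticeRep N) β x μ x₀ w (fun X hXs => ?_) X
  have hmem := mem_oneParamGenerators_unitaryGroup (n := Fin N) (X := X) hXs
  refine sdPairZd_of_oneParam (unitaryFundamentalLatticeRep N) hμ x μ x₀ w hXs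
    (k := fun t => ⟨NormedSpace.exp (t • X), hmem t⟩) (fun a b => Subtype.ext ?_) (fun t => ?_)
  · change NormedSpace.exp ((a + b) • X) = NormedSpace.exp (a • X) * NormedSpace.exp (b • X)
    rw [add_smul]
    exact Matrix.exp_add_of_commute _ _ (((Commute.refl X).smul_left a).smul_right b)
  · change NormedSpace.exp (t • X) = NormedSpace.exp ((t : ℂ) • X)
    rw [Complex.coe_smul]

end Concrete

end TiltedRP

end Summit.QuantumFields.GaugeBoot

end
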